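import Summits.Ventures.PercRepro.RankLevelSetLevelFiveAll
import Summits.Ventures.PercRepro.RankLevelSetFrameLarge

/-!
# PercRepro — SUB-CLAIM S2: the level-`5` window `7 ≤ p ≤ 834` of C-025, and its kernel reduction (p7, gen 0)

ACCELERATION ADDENDUM (README «ACCELERATION ADDENDUM», PLAN.md §ACCELERATION, RULING (ug)): the crux of record
`C025` is split into sub-claims; **S2** is the second piece of the gap of record (CHECKPOINT ADDENDUM 20) — the
level-`5` row on the explicit finite window `7 ≤ p ≤ 834`. Paper: `proofs/SUBCLAIM-S2-p7.md`.

* **`S2Window`** — the sub-claim as one `Prop`: `RLS M p 5` for every finite matroid and every `7 ≤ p ≤ 834`;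
* **`rls_five_all_of_s2`** / **`c025_five_all_of_s2`** — S2 together with THEOREM C₅ (`c025_five_large`, `p ≥ 835`,
  RankLevelSetLevelFiveAll) is the whole level-`5` row, in `RLS` and in the set-builder spelling of `C025`;
* **`rls_five_of_four_of_core`** — the `|E|`-induction wrapper `rls_succ_large 4 5 P` (RankLevelSetFrameLarge)
  with its corank-`≤ 5` clause discharged once and for all (`U = ∅` below corank `5`, Theorem M at corank `5`):
  level `4` for `p ≥ P` and the `e`-free core at level `5` for `p ≥ P` give level `5` for every `p ≥ P + 1`;
* **`rls_five_of_four_of_cells`** — the same with the corank-`≥ 28` core theorem `c025_core_five_twentyone`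
  (`p ≥ 50`, RankLevelSetCoreFour) applied: for `P ≥ 50` the core clause is the **22 corank cells** `6 ≤ d ≤ 27`;
* **`rls_five_window_of_cells`** — the sub-claim itself from three named inputs: level `5` on `7 ≤ p ≤ P` (the
  small cells), level `4` on `p ≥ P` (sub-claim S1 / S6), and the 22 corank cells of the core at `p ≥ P`;
* `c025_five_large_of_cells` — the sanity instance `P = 834`: night-1's `c025_core_five_bounded_corank` feeds
  the cells and THEOREM C₅ is recovered (the reduction has exactly the shape of the landed proof).

Nothing here proves a new cell; the file NAMES the gap: S2 is open exactly where `rls_five_window_of_cells`'s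
first and third inputs are open (see the paper section's cell map). Axioms: standard.
-/

open scoped Matroid

namespace PercRepro

namespace S2

open ThmN

variable {α : Type}

/-- **SUB-CLAIM S2** (ACCELERATION ADDENDUM): C-025 at level `5` on the explicit finite window `7 ≤ p ≤ 834` —
the second piece of the gap of record (CHECKPOINT ADDENDUM 20), in the tree's `RLS` vocabulary. -/
def S2Window : Prop :=
  ∀ {α : Type} (M : Matroid α) [M.Finite] (p : ℕ), 7 ≤ p → p ≤ 834 → RLS M p 5

/-- **The level-`5` row from S2**: with THEOREM C₅ (`c025_five_large`, every `p ≥ 835`) the window is all that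
separates the tree from C-025 at level `5` for every finite matroid and every `p ≥ 7`. -/
theorem rls_five_all_of_s2 (h : S2Window) (M : Matroid α) [M.Finite] (p : ℕ) (hp : 7 ≤ p) :
    RLS M p 5 := by
  rcases Nat.lt_or_ge p 835 with hlt | hge
  · exact h M p hp (by omega)
  · exact c025_five_large M p hge

/-- The level-`5` row from S2 in the set-builder vocabulary of `C025` (the `q = 5` instance, token for token). -/
theorem c025_five_all_of_s2 (h : S2Window) (M : Matroid α) [M.Finite] (p : ℕ) (hp : 7 ≤ p) :
    phiK p 5 * ({A : Set α | A ⊆ M.E ∧ M.eRk A = (p : ℕ∞) ∧ M.eRk (M.E \ A) = (5 : ℕ∞)}.ncard : ℚ) ≤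
      ({A : Set α | A ⊆ M.E ∧ (5 : ℕ∞) < M.eRk A ∧ M.eRk A < (p : ℕ∞)}.ncard : ℚ) :=
  rls_five_all_of_s2 h M p hp

/-- **The wrapper at level `5` with a free threshold** (`rls_succ_large 4 5 P`, corank `≤ 5` discharged): if
every finite matroid satisfies level `4` for all `p ≥ P` and the `e`-free core of rank `p ≥ P` and corank `≥ 6`
satisfies level `5`, then every finite matroid satisfies level `5` for all `p ≥ P + 1`. Below corank `5` the set
`U(p, 5)` is empty (`RLS_of_ncard_lt`); at corank `5` it is Theorem M (`RLS_of_ncard_eq`). -/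
theorem rls_five_of_four_of_core (P : ℕ) (hP : 6 ≤ P)
    (h4 : ∀ (M : Matroid α) [M.Finite] (p : ℕ), P ≤ p → RLS M p 4)
    (hcore : ∀ (M : Matroid α) [M.Finite] (p : ℕ), P ≤ p → M.eRank = (p : ℕ∞) → p + 5 < M.E.ncard →
      (∀ e ∈ M.E, ∃ A ⊆ M.E \ {e}, e ∉ M.closure A ∧ e ∉ M.closure ((M.E \ {e}) \ A)) → RLS M p 5) :
    ∀ (M : Matroid α) [M.Finite] (p : ℕ), P + 1 ≤ p → RLS M p 5 := by
  intro M _ p hp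
  refine rls_succ_large (α := α) 4 5 P ?_ ?_ ?_ M p hp (by omega)
  · -- level `4` for `p ≥ P`
    intro M' _ p' hP' _
    exact h4 M' p' hP'
  · -- corank `≤ 5`: `U = ∅` or Theorem M
    intro M' _ p' _ hn _
    rcases Nat.lt_or_ge M'.E.ncard (p' + 5) with h | h
    · exact RLS_of_ncard_lt M' h
    · exact RLS_of_ncard_eq M' (by omega)
  · -- the core
    intro M' _ p' hP' hR hbig _ hfree
    exact hcore M' p' hP' hR hbig hfree

/-- **The window's core clause is the 22 corank cells `6 ≤ d ≤ 27`** (for `P ≥ 50`): coranks `≥ 28` are the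
core theorem `c025_core_five_twentyone` (night-1, `p ≥ 50`); so level `4` for `p ≥ P` and the cells `(p, d)` of
the `e`-free core with `p ≥ P`, `6 ≤ d ≤ 27` give level `5` for every `p ≥ P + 1`. -/
theorem rls_five_of_four_of_cells (P : ℕ) (hP : 50 ≤ P)
    (h4 : ∀ (M : Matroid α) [M.Finite] (p : ℕ), P ≤ p → RLS M p 4)
    (hcells : ∀ (M : Matroid α) [M.Finite] (p d : ℕ), P ≤ p → 6 ≤ d → d ≤ 27 → M.eRank = (p : ℕ∞) →
      M.E.ncard = p + d →
      (∀ e ∈ M.E, ∃ A ⊆ M.E \ {e}, e ∉ M.closure A ∧ e ∉ M.closure ((M.E \ {e}) \ A)) → RLS M p 5) :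
    ∀ (M : Matroid α) [M.Finite] (p : ℕ), P + 1 ≤ p → RLS M p 5 := by
  refine rls_five_of_four_of_core P (by omega) h4 ?_
  intro M _ p hP' hR hbig hfree
  rcases Nat.lt_or_ge M.E.ncard (p + 28) with h | h
  · exact hcells M p (M.E.ncard - p) hP' (by omega) (by omega) hR (by omega) hfree
  · exact c025_core_five_twentyone M p (by omega) hR (by omega) hfree

/-- **S2 from its three named inputs** (`P ≥ 50`): the small cells `7 ≤ p ≤ P` at level `5`, level `4` on
`p ≥ P` (sub-claims S1 / S6), and the 22 corank cells of the `e`-free core at `p ≥ P`. -/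
theorem rls_five_window_of_cells (P : ℕ) (hP : 50 ≤ P)
    (hsmall : ∀ {α : Type} (M : Matroid α) [M.Finite] (p : ℕ), 7 ≤ p → p ≤ P → RLS M p 5)
    (h4 : ∀ {α : Type} (M : Matroid α) [M.Finite] (p : ℕ), P ≤ p → RLS M p 4)
    (hcells : ∀ {α : Type} (M : Matroid α) [M.Finite] (p d : ℕ), P ≤ p → 6 ≤ d → d ≤ 27 →
      M.eRank = (p : ℕ∞) → M.E.ncard = p + d →
      (∀ e ∈ M.E, ∃ A ⊆ M.E \ {e}, e ∉ M.closure A ∧ e ∉ M.closure ((M.E \ {e}) \ A)) → RLS M p 5) :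
    S2Window := by
  intro α M _ p hp _
  rcases Nat.lt_or_ge P p with hlt | hle
  · exact rls_five_of_four_of_cells P hP (fun M _ p hp => h4 M p hp)
      (fun M _ p d hp h6 h27 hR hn hfree => hcells M p d hp h6 h27 hR hn hfree) M p (by omega)
  · exact hsmall M p hp hle

/-- **Sanity instance, `P = 834`**: night-1's landed cells `c025_core_five_bounded_corank`
(RankLevelSetLevelFive) and THEOREM C₄ (`c025_four_large`, `p ≥ 60`) recover THEOREM C₅ through the reduction —
the reduction has exactly the shape of the landed proof of `c025_five_of_four`. -/
theorem c025_five_large_of_cells (M : Matroid α) [M.Finite] (p : ℕ) (hp : 835 ≤ p) : RLS M p 5 :=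
  rls_five_of_four_of_cells 834 (by norm_num) (fun M _ p hp => c025_four_large M p (by omega))
    (fun M _ p d hp h6 h27 hR hn hfree => c025_core_five_bounded_corank M p d hp h6 h27 hR hn hfree)
    M p hp

end S2

end PercRepro
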